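import Summits.ValiantsHypothesis.ValiantsHypothesis.Theorems.SymPencilPerFourHyperplaneFlowCellOfCore
import Summits.ValiantsHypothesis.ValiantsHypothesis.Theorems.SymPencilPerFourHyperplanePencilZeroOne

/-!
# Route `SymPencil` — cell `(12,4,2)` of the size-27 kernel-package table is EMPTY, unconditionally
# (`--supports` stmt-ValiantsHypothesis-5674; rung currency for `sdc(per₄)`; nothing here bears on
# `VP ≠ VNP`)

Assembly of the `(12,4,2)` chain (memo `Cruxes/SdcSuperquadratic/CELL-TWELVE-FOUR.md`):

* `SymPencilSdcPerFourCellTwelveFour.false_of_rank_twelve_le_twentySeven_of_rigid` (w2 g2): the cell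
  is empty modulo the hyperplane flow rigidity `RIG_𝟙`;
* `SymPencilPerFourHyperplaneFlow.rigid_of_pencilCore` /
  `…false_of_rank_twelve_le_twentySeven_of_pencilCore` (val-lit-p4 g14): `RIG_𝟙` — and hence the
  cell — modulo the one-row pencil core S1c;
* `SymPencilPerFourHyperplanePencilZeroOne.exists_kernel_hyperplane_of_pencil_flow` (w2 g2): S1c,
  unconditionally.

Hence `hyperplane_flow_rigidity_ones` (`RIG_𝟙`) and **`false_of_rank_twelve_le_twentySeven`**: a
symmetric affine determinantal representation of `per₄` of size `m ≤ 27` whose kernel package at a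
base point has a one-row kernel of rank `12` does not exist.  This is ONE of the five/six size-27
cells; the window `27 ≤ sdc(per₄) ≤ 29` is unchanged by this file alone.  Elementary. [folklore]
-/

noncomputable section

-- single-conjunct layout: Sub = Summit, duplicated namespace component intended
set_option linter.dupNamespace false

namespace Summit.ValiantsHypothesis.ValiantsHypothesis.Theorems.SymPencilSdcPerFourCellTwelveFourClosed

open Matrix Module MvPolynomial
open Literature.Computability.AlgebraicComplexity
open Summit.ValiantsHypothesis.ValiantsHypothesis.Theorems.SymPencilPerFourHyperplanePencilZeroOne
  (exists_kernel_hyperplane_of_pencil_flow)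

variable {K : Type*} [Field K] [CharZero K]

/-- **`RIG_𝟙` — hyperplane flow rigidity of `per [𝟙; ·]`, unconditional**: a linear vector field
`X` on `K^{3×4}` whose flow preserves `y ↦ per [𝟙; y₀; y₁; y₂]` on a hyperplane `ker ℓ` has a zero
`y ∈ ker ℓ` with `per [𝟙; y] ≠ 0`. [folklore] -/
theorem hyperplane_flow_rigidity_ones
    (X : (Fin 3 → Fin 4 → K) →ₗ[K] (Fin 3 → Fin 4 → K)) (ℓ : (Fin 3 → Fin 4 → K) →ₗ[K] K)
    (h : ∀ y, ℓ y = 0 → ∀ t : K,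
      (Matrix.of ![fun _ => (1 : K), (y + t • X y) 0, (y + t • X y) 1, (y + t • X y) 2]).permanent =
        (Matrix.of ![fun _ => (1 : K), y 0, y 1, y 2]).permanent) :
    ∃ y, ℓ y = 0 ∧ X y = 0 ∧ (Matrix.of ![fun _ => (1 : K), y 0, y 1, y 2]).permanent ≠ 0 :=
  SymPencilPerFourHyperplaneFlow.rigid_of_pencilCore
    (fun X₀ X₁ X₂ μ hμ hf => exists_kernel_hyperplane_of_pencil_flow X₀ X₁ X₂ μ hμ hf) X ℓ h

/-- **Cell `(12,4,2)` of the size-27 table is EMPTY** (unconditional): the binder block of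
`SymPencilSdcPerFourCellTwelveFour.false_of_rank_twelve_le_twentySeven_of_rigid` without `hrig`.
[folklore] -/
theorem false_of_rank_twelve_le_twentySeven [IsAlgClosed K] {m : ℕ} (hm : m ≤ 27)
    {i₀ : Fin m} {D : Matrix {i // i ≠ i₀} {i // i ≠ i₀} K}
    {bL : (Fin 4 × Fin 4 → K) →ₗ[K] ({i // i ≠ i₀} → K)}
    {CL : (Fin 4 × Fin 4 → K) →ₗ[K] Matrix {i // i ≠ i₀} {i // i ≠ i₀} K} {κ : K}
    (hD : IsUnit D.det) (hDs : Dᵀ = D) (hCs : ∀ z, (CL z)ᵀ = CL z) (hκ : κ ≠ 0)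
    (hi : ∀ z, bL z ⬝ᵥ D⁻¹ *ᵥ bL z = 0)
    (hii : ∀ z, bL z ⬝ᵥ (D⁻¹ * CL z * D⁻¹) *ᵥ bL z = 0)
    (hiii : ∀ z, D.det * (bL z ⬝ᵥ (D⁻¹ * CL z * D⁻¹ * CL z * D⁻¹) *ᵥ bL z) =
      -(κ * eval z (perPoly (Fin 4) K)))
    (hcard : Fintype.card {i // i ≠ i₀} + 1 = m)
    (hrn : finrank K (LinearMap.range bL) + finrank K (LinearMap.ker bL) = 16)
    (hN : ∀ v, bL v = 0 → IsUnit (D + CL v).det ∧ ∀ (z : Fin 4 × Fin 4 → K) (s : K),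
      κ * eval (v + s • z) (perPoly (Fin 4) K) =
        (Matrix.fromBlocks ((s * 0) • (1 : Matrix Unit Unit K))
          (Matrix.replicateRow Unit (s • bL z)) (Matrix.replicateCol Unit (s • bL z))
          (D + CL v + s • CL z)).det)
    (h12 : finrank K (LinearMap.range bL) = 12) : False :=
  SymPencilPerFourHyperplaneFlow.false_of_rank_twelve_le_twentySeven_of_pencilCore hm hD hDs hCs hκ
    hi hii hiii hcard hrn hN
    (fun X₀ X₁ X₂ μ hμ hf => exists_kernel_hyperplane_of_pencil_flow X₀ X₁ X₂ μ hμ hf) h12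

end Summit.ValiantsHypothesis.ValiantsHypothesis.Theorems.SymPencilSdcPerFourCellTwelveFourClosed

end
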